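import Mathlib
import Summits.NavierStokesRegularity.NavierStokesRegularity.Theorems.EulerZoomLiouvillePowerGaugeEulerLiouvilleAffineTimePast
import HarnessLib

/-!
# Crux `EulerZoomLiouville.PowerGaugeEulerLiouville` (stmt-NavierStokesRegularity-19832), stub `stub_nonSelfSimilarRest`:
# members that are POLYNOMIAL IN TIME on a past slab (`∂ₜ^{N+1} u = 0` in the a.e. sense) are trivial

Helper file (theorems only; `--supports stmt-NavierStokesRegularity-19832`; def-free).  Hand leafhand-ns-eulerzoomliouville-11 g0;
sequel to `…AffineTimePast` (degree `1`).

THE STRATUM.  A member `(u, p, H, c)` of Seregin's power-gauged class (`ρ > 0`) whose velocity is a POLYNOMIAL IN TIME of some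
degree `N` on a past slab — `u(τ, x) = Σ_{k ≤ N} τ^k U_k(x)` for a.e. `(τ, x) ∈ (−∞, T₁) × ℝ³`, some `T₁ ≤ 0`, coefficients
`U_k : ℝ³ → ℝ³` ARBITRARY (no measurability, regularity or decay) — vanishes a.e. on the whole slab
(`PolyPast.ae_eq_zero_of_gauge_of_aePolynomialPast`, binder form `Birth.nonSelfSimilar_of_aePolynomialTimePast`).

PROOF (induction on the degree; large-scale arithmetic of the `A`-gauge; Euler enters only through the a.e.-steady stratum at the
end).  TOP COEFFICIENT (`PolyPast.top_coeff_ae_eq_zero`): for `a² ≥ −2T₁` put `h = a²/(4N)` and pick a GOOD node `τ₀ ∈ (−a², −¾a²)`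
such that all `N+1` slices `u(τ₀ + jh)`, `j ≤ N`, are locally integrable and equal to the polynomial slice a.e. (a.e. node is good:
translation invariance of Lebesgue measure + countable intersection).  The `N`-th finite difference with step `h` annihilates the
monomials `τ^k`, `k < N`, and maps `τ^N` to `N! h^N` (Mathlib's `fwdDiff_iter_pow_eq_zero_of_lt`, `fwdDiff_iter_eq_factorial`, rescaled
to step `h` by `PolyPast.fwdDiff_iter_one_comp_mul`), so `N! h^N U_N = Σ_j (−1)^{N−j} C(N,j) u(τ₀ + jh)` a.e.; the `A`-gauge bound
`∫_{B_a}|u(s)|² ≤ c a^{1−2ρ}` on the window (`Backward.lintegral_ball_le_of_gaugeA`) and Cauchy–Schwarz give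
`(N! h^N)² ∫_{B_a}|U_N|² ≤ (N+1) (Σ_j C(N,j)²) c a^{1−2ρ}`, i.e. `∫_{B_R}|U_N|² ≤ K_N c a^{1−2ρ−4N} → 0`: `U_N = 0` a.e.  DESCENT: the
member is then a.e. a polynomial of degree `N − 1`; degree `0` is the a.e.-steady stratum (`AePastSteady`).

WHAT THIS IS NOT: not a proof of the stub or of the crux; nothing about Navier–Stokes. [folklore]
-/

noncomputable section

-- flat `Theorems/<Route><Decl>…` files of one crux share the namespace of the crux (tree convention)
set_option linter.dupNamespace false

open MeasureTheory Set Filter Topology Metric Function TopologicalSpace Finset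
open scoped RealInnerProductSpace NNReal ENNReal Nat

namespace Summit.NavierStokesRegularity.NavierStokesRegularity.Theorems.PowerGaugeEulerLiouville

open Literature.Analysis Literature.Analysis.FunctionSpaces Literature.Analysis.FluidPDE

namespace PolyPast

/-! ## 1. Finite differences of polynomials with an arbitrary step -/

/-- Rescaling the step of an iterated forward difference: `Δ₁ⁿ (s ↦ f (s h)) (s) = Δₕⁿ f (s h)`. [folklore] -/
theorem fwdDiff_iter_one_comp_mul {V : Type*} [AddCommGroup V] (h : ℝ) (n : ℕ) (f : ℝ → V) (s : ℝ) :
    (fwdDiff (1 : ℝ))^[n] (fun s : ℝ => f (s * h)) s = (fwdDiff h)^[n] f (s * h) := by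
  induction n generalizing f s with
  | zero => simp
  | succ n ih =>
    have e : fwdDiff (1 : ℝ) (fun s : ℝ => f (s * h)) = fun s : ℝ => (fwdDiff h f) (s * h) := by
      funext s
      simp only [fwdDiff, add_mul, one_mul]
    rw [iterate_succ_apply, iterate_succ_apply, e, ih]

/-- The `M`-th finite difference with step `h` of the monomial `τ^k`, written as the Newton sum over the nodes `τ₀ + j h`:
it vanishes for `k < M`. [folklore] -/
theorem newtonSum_pow_eq_zero_of_lt {k M : ℕ} (hk : k < M) (τ₀ h : ℝ) (hh : h ≠ 0) :
    ∑ j ∈ range (M + 1), ((-1 : ℝ) ^ (M - j) * (M.choose j : ℝ)) * (τ₀ + (j : ℝ) * h) ^ k = 0 := by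
  have h1 := fwdDiff_iter_eq_sum_shift (h := h) (fun t : ℝ => t ^ k) M τ₀
  have h2 : (fwdDiff h)^[M] (fun t : ℝ => t ^ k) τ₀ = 0 := by
    have h3 := fwdDiff_iter_one_comp_mul h M (fun t : ℝ => t ^ k) (τ₀ / h)
    rw [div_mul_cancel₀ τ₀ hh] at h3
    rw [← h3]
    have e : (fun s : ℝ => (s * h) ^ k) = h ^ k • fun s : ℝ => s ^ k := by
      funext s; simp [mul_pow, mul_comm]
    rw [e, fwdDiff_iter_const_smul, fwdDiff_iter_pow_eq_zero_of_lt hk]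
    simp
  rw [h2] at h1
  rw [h1]
  refine Finset.sum_congr rfl fun j _ => ?_
  rw [zsmul_eq_mul, nsmul_eq_mul]
  push_cast
  ring

/-- … and equals `M! h^M` for `k = M`. [folklore] -/
theorem newtonSum_pow_self (M : ℕ) (τ₀ h : ℝ) (hh : h ≠ 0) :
    ∑ j ∈ range (M + 1), ((-1 : ℝ) ^ (M - j) * (M.choose j : ℝ)) * (τ₀ + (j : ℝ) * h) ^ M = (M ! : ℝ) * h ^ M := by
  have h1 := fwdDiff_iter_eq_sum_shift (h := h) (fun t : ℝ => t ^ M) M τ₀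
  have h2 : (fwdDiff h)^[M] (fun t : ℝ => t ^ M) τ₀ = (M ! : ℝ) * h ^ M := by
    have h3 := fwdDiff_iter_one_comp_mul h M (fun t : ℝ => t ^ M) (τ₀ / h)
    rw [div_mul_cancel₀ τ₀ hh] at h3
    rw [← h3]
    have e : (fun s : ℝ => (s * h) ^ M) = h ^ M • fun s : ℝ => s ^ M := by
      funext s; simp [mul_pow, mul_comm]
    rw [e, fwdDiff_iter_const_smul, fwdDiff_iter_eq_factorial]
    simp [mul_comm]
  rw [h2] at h1
  rw [h1]
  refine Finset.sum_congr rfl fun j _ => ?_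
  rw [zsmul_eq_mul, nsmul_eq_mul]
  push_cast
  ring

/-- **Newton's finite-difference identity for vector polynomials in time**: for `P(τ) = Σ_{k ≤ M} τ^k • W_k`,
`Σ_{j ≤ M} (−1)^{M−j} C(M,j) • P(τ₀ + j h) = (M! h^M) • W_M`. [folklore] -/
theorem newtonSum_poly_eq_top {V : Type*} [AddCommGroup V] [Module ℝ V] (M : ℕ) (W : ℕ → V) (τ₀ h : ℝ) (hh : h ≠ 0) :
    ∑ j ∈ range (M + 1), ((-1 : ℝ) ^ (M - j) * (M.choose j : ℝ)) •
        (∑ k ∈ range (M + 1), (τ₀ + (j : ℝ) * h) ^ k • W k) = ((M ! : ℝ) * h ^ M) • W M := by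
  calc ∑ j ∈ range (M + 1), ((-1 : ℝ) ^ (M - j) * (M.choose j : ℝ)) •
        (∑ k ∈ range (M + 1), (τ₀ + (j : ℝ) * h) ^ k • W k)
      = ∑ k ∈ range (M + 1), (∑ j ∈ range (M + 1),
          ((-1 : ℝ) ^ (M - j) * (M.choose j : ℝ)) * (τ₀ + (j : ℝ) * h) ^ k) • W k := by
        simp_rw [Finset.smul_sum, smul_smul, Finset.sum_smul]
        rw [Finset.sum_comm]
    _ = ∑ k ∈ range M, (∑ j ∈ range (M + 1),
          ((-1 : ℝ) ^ (M - j) * (M.choose j : ℝ)) * (τ₀ + (j : ℝ) * h) ^ k) • W k + ((M ! : ℝ) * h ^ M) • W M := by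
        rw [Finset.sum_range_succ, newtonSum_pow_self M τ₀ h hh]
    _ = ((M ! : ℝ) * h ^ M) • W M := by
        rw [Finset.sum_eq_zero fun k hk => ?_, zero_add]
        rw [newtonSum_pow_eq_zero_of_lt (mem_range.1 hk) τ₀ h hh, zero_smul]

/-! ## 2. Pointwise Cauchy–Schwarz in the extended-norm form -/
/-- `‖Σ_j c_j • v_j‖ₑ² ≤ (#s) · Σ_j c_j² ‖v_j‖ₑ²` (Cauchy–Schwarz), in the form used under `∫⁻`. [folklore] -/
theorem enorm_sq_sum_smul_le (s : Finset ℕ) (c : ℕ → ℝ) (v : ℕ → EuclideanSpace ℝ (Fin 3)) :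
    ‖∑ j ∈ s, c j • v j‖ₑ ^ 2 ≤ (s.card : ℝ≥0∞) * ∑ j ∈ s, ENNReal.ofReal (c j ^ 2) * ‖v j‖ₑ ^ 2 := by
  have hreal : ‖∑ j ∈ s, c j • v j‖ ^ 2 ≤ (s.card : ℝ) * ∑ j ∈ s, c j ^ 2 * ‖v j‖ ^ 2 := by
    have h1 : ‖∑ j ∈ s, c j • v j‖ ≤ ∑ j ∈ s, ‖c j • v j‖ := norm_sum_le _ _
    have h2 : (∑ j ∈ s, ‖c j • v j‖) ^ 2 ≤ (s.card : ℝ) * ∑ j ∈ s, ‖c j • v j‖ ^ 2 :=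
      sq_sum_le_card_mul_sum_sq
    have h3 : ∑ j ∈ s, ‖c j • v j‖ ^ 2 = ∑ j ∈ s, c j ^ 2 * ‖v j‖ ^ 2 := by
      refine Finset.sum_congr rfl fun j _ => ?_
      rw [norm_smul, mul_pow, Real.norm_eq_abs, sq_abs]
    calc ‖∑ j ∈ s, c j • v j‖ ^ 2 ≤ (∑ j ∈ s, ‖c j • v j‖) ^ 2 :=
          pow_le_pow_left₀ (norm_nonneg _) h1 2
      _ ≤ (s.card : ℝ) * ∑ j ∈ s, c j ^ 2 * ‖v j‖ ^ 2 := by rw [← h3]; exact h2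
  have e1 : ‖∑ j ∈ s, c j • v j‖ₑ ^ 2 = ENNReal.ofReal (‖∑ j ∈ s, c j • v j‖ ^ 2) := by
    rw [← ofReal_norm, ENNReal.ofReal_pow (norm_nonneg _)]
  have e2 : ∀ j, ENNReal.ofReal (c j ^ 2) * ‖v j‖ₑ ^ 2 = ENNReal.ofReal (c j ^ 2 * ‖v j‖ ^ 2) := by
    intro j
    rw [← ofReal_norm, ← ENNReal.ofReal_pow (norm_nonneg _), ← ENNReal.ofReal_mul (sq_nonneg _)]
  rw [e1]
  calc ENNReal.ofReal (‖∑ j ∈ s, c j • v j‖ ^ 2)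
      ≤ ENNReal.ofReal ((s.card : ℝ) * ∑ j ∈ s, c j ^ 2 * ‖v j‖ ^ 2) := ENNReal.ofReal_le_ofReal hreal
    _ = (s.card : ℝ≥0∞) * ∑ j ∈ s, ENNReal.ofReal (c j ^ 2) * ‖v j‖ₑ ^ 2 := by
        rw [ENNReal.ofReal_mul (by positivity), ENNReal.ofReal_natCast,
          ENNReal.ofReal_sum_of_nonneg fun j _ => by positivity]
        simp_rw [e2]

/-! ## 3. Good nodes in arithmetic progression -/
/-- If a property holds for a.e. `τ < T₁`, then for a.e. `τ₀` ALL the nodes `τ₀ + j h` (`j : ℕ`) lying below `T₁` have it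
(translation invariance of Lebesgue measure, countable intersection). [folklore] -/
theorem ae_forall_nodes {G : ℝ → Prop} {T₁ : ℝ} (hG : ∀ᵐ τ ∂(volume.restrict (Iio T₁)), G τ) (h : ℝ) :
    ∀ᵐ τ₀ ∂(volume : Measure ℝ), ∀ j : ℕ, τ₀ + (j : ℝ) * h < T₁ → G (τ₀ + (j : ℝ) * h) := by
  have h0 : ∀ᵐ τ ∂(volume : Measure ℝ), τ ∈ Iio T₁ → G τ := (ae_restrict_iff' measurableSet_Iio).1 hG
  refine ae_all_iff.2 fun j => ?_
  have hmp := (measurePreserving_add_right (volume : Measure ℝ) ((j : ℝ) * h)).quasiMeasurePreserving.ae h0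
  filter_upwards [hmp] with τ hτ
  exact hτ

/-! ## 4. The top coefficient of a polynomial-in-time member vanishes -/
/-- **Top-coefficient kill.**  Let `u` have, for a.e. `τ < T₁` (`T₁ ≤ 0`), a locally integrable slice equal a.e. to the polynomial
slice `Σ_{k ≤ M} τ^k • W_k`, `M ≥ 1`, and let the `A`-gauge bound `∫_{B_a} |u(s)|² ≤ c a^{1−2ρ}` hold on every window
`s ∈ (−a², 0)`, `a > 0` (`ρ > 0`).  Then `W_M = 0` a.e. [folklore] -/
theorem top_coeff_ae_eq_zero {ρ : ℝ} (hρ : 0 < ρ)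
    {u : ℝ → EuclideanSpace ℝ (Fin 3) → EuclideanSpace ℝ (Fin 3)} {c : ℝ≥0} {T₁ : ℝ} (hT₁ : T₁ ≤ 0)
    {M : ℕ} (hM : 1 ≤ M) {W : ℕ → EuclideanSpace ℝ (Fin 3) → EuclideanSpace ℝ (Fin 3)}
    (hgood : ∀ᵐ τ ∂(volume.restrict (Iio T₁)), LocallyIntegrable (u τ) volume ∧
      ∀ᵐ x ∂(volume : Measure (EuclideanSpace ℝ (Fin 3))), u τ x = ∑ k ∈ range (M + 1), τ ^ k • W k x)
    (hA : ∀ a : ℝ, 0 < a → ∀ s ∈ Ioo (-(a ^ 2)) 0,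
      ∫⁻ x in ball (0 : EuclideanSpace ℝ (Fin 3)) a, ‖u s x‖ₑ ^ 2 ≤ ENNReal.ofReal ((c : ℝ) * a ^ (1 - 2 * ρ))) :
    ∀ᵐ x ∂(volume : Measure (EuclideanSpace ℝ (Fin 3))), W M x = 0 := by
  -- Newton coefficients and their square sum
  set cf : ℕ → ℝ := fun j => (-1 : ℝ) ^ (M - j) * (M.choose j : ℝ) with hcf
  set S : ℝ := ∑ j ∈ range (M + 1), cf j ^ 2 with hS
  have hS0 : 0 ≤ S := Finset.sum_nonneg fun j _ => sq_nonneg _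
  have hMpos : (0 : ℝ) < M := by exact_mod_cast hM
  -- (1) for every `a` with `a² ≥ -2 T₁`: measurability of `W M` and the bound on `B_a`
  have hstep : ∀ a : ℝ, 0 < a → -2 * T₁ ≤ a ^ 2 →
      AEStronglyMeasurable (W M) volume ∧
      ENNReal.ofReal (((M ! : ℝ) * (a ^ 2 / (4 * M)) ^ M) ^ 2) *
          ∫⁻ x in ball (0 : EuclideanSpace ℝ (Fin 3)) a, ‖W M x‖ₑ ^ 2 ≤
        ENNReal.ofReal (((M : ℝ) + 1) * S * ((c : ℝ) * a ^ (1 - 2 * ρ))) := by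
    intro a ha ha2
    set h : ℝ := a ^ 2 / (4 * M) with hh
    have hhpos : 0 < h := by positivity
    have hhne : h ≠ 0 := hhpos.ne'
    -- a good base node `τ₀ ∈ (−a², −3a²/4)`
    have hwin : volume (Ioo (-(a ^ 2)) (-(3 * a ^ 2) / 4)) ≠ 0 := by
      rw [Real.volume_Ioo]; exact (ENNReal.ofReal_pos.2 (by nlinarith)).ne'
    have hnodes := ae_forall_nodes hgood h
    obtain ⟨τ₀, hτ₀, hG⟩ := Measure.exists_mem_of_measure_ne_zero_of_ae hwin (ae_restrict_of_ae hnodes)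
    -- all nodes `τ₀ + j h`, `j ≤ M`, lie in `(−a², T₁)` and in the window `(−a², 0)`
    have hnode_lt : ∀ j ∈ range (M + 1), τ₀ + (j : ℝ) * h < T₁ ∧ τ₀ + (j : ℝ) * h ∈ Ioo (-(a ^ 2)) 0 := by
      intro j hj
      have hjM : (j : ℝ) ≤ M := by exact_mod_cast Nat.lt_succ_iff.1 (mem_range.1 hj)
      have hj0 : (0 : ℝ) ≤ j := by positivity
      have hjh : (j : ℝ) * h ≤ a ^ 2 / 4 := by
        calc (j : ℝ) * h ≤ (M : ℝ) * h := by gcongr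
          _ = a ^ 2 / 4 := by rw [hh]; field_simp
      have h1 : τ₀ + (j : ℝ) * h < T₁ := by have := hτ₀.2; nlinarith
      refine ⟨h1, ⟨?_, lt_of_lt_of_le h1 hT₁⟩⟩
      have := hτ₀.1; nlinarith
    have hGj : ∀ j ∈ range (M + 1), LocallyIntegrable (u (τ₀ + (j : ℝ) * h)) volume ∧
        ∀ᵐ x ∂(volume : Measure (EuclideanSpace ℝ (Fin 3))),
          u (τ₀ + (j : ℝ) * h) x = ∑ k ∈ range (M + 1), (τ₀ + (j : ℝ) * h) ^ k • W k x :=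
      fun j hj => hG j (hnode_lt j hj).1
    -- measurability of the polynomial slices at the nodes and of `W M`
    have hmeas : ∀ j ∈ range (M + 1),
        AEStronglyMeasurable (fun x => ∑ k ∈ range (M + 1), (τ₀ + (j : ℝ) * h) ^ k • W k x) volume :=
      fun j hj => (hGj j hj).1.aestronglyMeasurable.congr (hGj j hj).2
    have hNewton : ∀ x, ((M ! : ℝ) * h ^ M) • W M x =
        ∑ j ∈ range (M + 1), cf j • (∑ k ∈ range (M + 1), (τ₀ + (j : ℝ) * h) ^ k • W k x) :=
      fun x => (newtonSum_poly_eq_top M (fun k => W k x) τ₀ h hhne).symm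
    have hr : (M ! : ℝ) * h ^ M ≠ 0 := by positivity
    have hWmeas : AEStronglyMeasurable (W M) volume := by
      have hsum : AEStronglyMeasurable (fun x => ∑ j ∈ range (M + 1),
          cf j • (∑ k ∈ range (M + 1), (τ₀ + (j : ℝ) * h) ^ k • W k x)) volume :=
        Finset.aestronglyMeasurable_fun_sum
          (f := fun j x => cf j • (∑ k ∈ range (M + 1), (τ₀ + (j : ℝ) * h) ^ k • W k x)) (range (M + 1))
          fun j hj => (hmeas j hj).const_smul (cf j)
      have e : W M = ((M ! : ℝ) * h ^ M)⁻¹ • fun x => ∑ j ∈ range (M + 1),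
          cf j • (∑ k ∈ range (M + 1), (τ₀ + (j : ℝ) * h) ^ k • W k x) := by
        funext x
        rw [Pi.smul_apply, ← hNewton x, smul_smul, inv_mul_cancel₀ hr, one_smul]
      rw [e]
      exact hsum.const_smul _
    refine ⟨hWmeas, ?_⟩
    -- slice bounds at the nodes
    have hb : ∀ j ∈ range (M + 1),
        ∫⁻ x in ball (0 : EuclideanSpace ℝ (Fin 3)) a, ‖∑ k ∈ range (M + 1), (τ₀ + (j : ℝ) * h) ^ k • W k x‖ₑ ^ 2 ≤
          ENNReal.ofReal ((c : ℝ) * a ^ (1 - 2 * ρ)) := by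
      intro j hj
      have h1 := hA a ha _ (hnode_lt j hj).2
      refine le_of_eq_of_le ?_ h1
      refine lintegral_congr_ae (ae_restrict_of_ae ?_)
      filter_upwards [(hGj j hj).2] with x hx
      rw [hx]
    -- the estimate
    have hne : ENNReal.ofReal (((M ! : ℝ) * h ^ M) ^ 2) ≠ ∞ := ENNReal.ofReal_ne_top
    calc ENNReal.ofReal (((M ! : ℝ) * h ^ M) ^ 2) * ∫⁻ x in ball (0 : EuclideanSpace ℝ (Fin 3)) a, ‖W M x‖ₑ ^ 2
        = ∫⁻ x in ball (0 : EuclideanSpace ℝ (Fin 3)) a, ‖((M ! : ℝ) * h ^ M) • W M x‖ₑ ^ 2 := by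
          rw [← lintegral_const_mul' _ _ hne]
          have epw : ∀ (r : ℝ) (w : EuclideanSpace ℝ (Fin 3)), ENNReal.ofReal (r ^ 2) * ‖w‖ₑ ^ 2 = ‖r • w‖ₑ ^ 2 := by
            intro r w
            rw [enorm_smul, mul_pow, Real.enorm_eq_ofReal_abs, ← ENNReal.ofReal_pow (abs_nonneg _), sq_abs]
          exact lintegral_congr fun x => epw _ _
      _ = ∫⁻ x in ball (0 : EuclideanSpace ℝ (Fin 3)) a,
            ‖∑ j ∈ range (M + 1), cf j • (∑ k ∈ range (M + 1), (τ₀ + (j : ℝ) * h) ^ k • W k x)‖ₑ ^ 2 := by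
          refine lintegral_congr fun x => ?_
          rw [hNewton x]
      _ ≤ ∫⁻ x in ball (0 : EuclideanSpace ℝ (Fin 3)) a, ((range (M + 1)).card : ℝ≥0∞) *
            ∑ j ∈ range (M + 1), ENNReal.ofReal (cf j ^ 2) *
              ‖∑ k ∈ range (M + 1), (τ₀ + (j : ℝ) * h) ^ k • W k x‖ₑ ^ 2 :=
          lintegral_mono fun x => enorm_sq_sum_smul_le (range (M + 1)) cf
            (fun j => ∑ k ∈ range (M + 1), (τ₀ + (j : ℝ) * h) ^ k • W k x)
      _ = ((range (M + 1)).card : ℝ≥0∞) * ∑ j ∈ range (M + 1), ENNReal.ofReal (cf j ^ 2) *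
            ∫⁻ x in ball (0 : EuclideanSpace ℝ (Fin 3)) a,
              ‖∑ k ∈ range (M + 1), (τ₀ + (j : ℝ) * h) ^ k • W k x‖ₑ ^ 2 := by
          rw [lintegral_const_mul' _ _ (ENNReal.natCast_ne_top _)]
          congr 1
          rw [lintegral_finsetSum' _ fun j hj => ?_]
          · refine Finset.sum_congr rfl fun j hj => ?_
            rw [lintegral_const_mul' _ _ ENNReal.ofReal_ne_top]
          · exact ((hmeas j hj).restrict.enorm.pow_const 2).const_mul _
      _ ≤ ((range (M + 1)).card : ℝ≥0∞) * ∑ j ∈ range (M + 1), ENNReal.ofReal (cf j ^ 2) *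
            ENNReal.ofReal ((c : ℝ) * a ^ (1 - 2 * ρ)) := by
          gcongr with j hj
          exact hb j hj
      _ = ENNReal.ofReal (((M : ℝ) + 1) * S * ((c : ℝ) * a ^ (1 - 2 * ρ))) := by
          rw [← Finset.sum_mul, Finset.card_range, ← ENNReal.ofReal_sum_of_nonneg (fun j _ => sq_nonneg (cf j)),
            ← hS, ← ENNReal.ofReal_natCast, Nat.cast_succ, ← ENNReal.ofReal_mul hS0,
            ← ENNReal.ofReal_mul (by positivity : (0 : ℝ) ≤ (M : ℝ) + 1)]
          congr 1
          ring
  -- (2) `W M = 0` a.e. on every ball, hence on `ℝ³`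
  obtain ⟨a₀, ha₀pos, ha₀⟩ : ∃ a₀ : ℝ, 0 < a₀ ∧ -2 * T₁ ≤ a₀ ^ 2 := by
    refine ⟨1 - 2 * T₁, by linarith, ?_⟩
    nlinarith
  have hWmeas : AEStronglyMeasurable (W M) volume := (hstep a₀ ha₀pos ha₀).1
  have hM1 : (1 : ℝ) ≤ M := by exact_mod_cast hM
  -- the real constant in front of the decaying power
  set L : ℝ := ((M : ℝ) + 1) * S * (c : ℝ) * (4 * (M : ℝ)) ^ (2 * M) / (M ! : ℝ) ^ 2 with hL
  have hball : ∀ R : ℝ, 0 < R → ∫⁻ x in ball (0 : EuclideanSpace ℝ (Fin 3)) R, ‖W M x‖ₑ ^ 2 = 0 := by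
    intro R hR
    refine nonpos_iff_eq_zero.1 ?_
    have hlim : Tendsto (fun a : ℝ => ENNReal.ofReal (L * a ^ (-(4 * (M : ℝ) - 1 + 2 * ρ)))) atTop (𝓝 0) := by
      rw [show (0 : ℝ≥0∞) = ENNReal.ofReal (L * 0) by simp]
      exact ENNReal.tendsto_ofReal ((tendsto_rpow_neg_atTop (by linarith)).const_mul _)
    refine ge_of_tendsto hlim ?_
    filter_upwards [eventually_ge_atTop (max a₀ R)] with a ha
    have haR : R ≤ a := le_trans (le_max_right _ _) ha
    have ha₀a : a₀ ≤ a := le_trans (le_max_left _ _) ha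
    have hapos : 0 < a := lt_of_lt_of_le hR haR
    have ha2 : -2 * T₁ ≤ a ^ 2 := le_trans ha₀ (pow_le_pow_left₀ ha₀pos.le ha₀a 2)
    have h1 := (hstep a hapos ha2).2
    have hrpos : 0 < ((M ! : ℝ) * (a ^ 2 / (4 * M)) ^ M) ^ 2 := by positivity
    have hpos : ENNReal.ofReal (((M ! : ℝ) * (a ^ 2 / (4 * M)) ^ M) ^ 2) ≠ 0 := by
      rw [ENNReal.ofReal_ne_zero_iff]; exact hrpos
    have h2 : ∫⁻ x in ball (0 : EuclideanSpace ℝ (Fin 3)) a, ‖W M x‖ₑ ^ 2 ≤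
        (ENNReal.ofReal (((M ! : ℝ) * (a ^ 2 / (4 * M)) ^ M) ^ 2))⁻¹ *
          ENNReal.ofReal (((M : ℝ) + 1) * S * ((c : ℝ) * a ^ (1 - 2 * ρ))) := by
      rw [← ENNReal.div_eq_inv_mul]
      exact ENNReal.le_div_iff_mul_le (Or.inl hpos) (Or.inl ENNReal.ofReal_ne_top) |>.2 (by rwa [mul_comm])
    refine le_trans (lintegral_mono_set (ball_subset_ball haR)) (le_trans h2 (le_of_eq ?_))
    rw [← ENNReal.ofReal_inv_of_pos hrpos, ← ENNReal.ofReal_mul (by positivity)]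
    congr 1
    -- real arithmetic: `(r²)⁻¹ · ((M+1) S c a^{1-2ρ}) = L · a^{-(4M-1+2ρ)}`
    have ha' : a ≠ 0 := hapos.ne'
    have hM0 : (M : ℝ) ≠ 0 := hMpos.ne'
    have hfact : (M ! : ℝ) ≠ 0 := by positivity
    have e1 : (a ^ 2 / (4 * M)) ^ M = a ^ (2 * (M : ℝ)) / (4 * (M : ℝ)) ^ M := by
      rw [div_pow, ← Real.rpow_natCast a, ← Real.rpow_natCast, ← Real.rpow_mul hapos.le]
      push_cast
      ring_nf
    have e2 : a ^ (-(4 * (M : ℝ) - 1 + 2 * ρ)) = a ^ (1 - 2 * ρ) / (a ^ (2 * (M : ℝ))) ^ 2 := by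
      rw [← Real.rpow_natCast (a ^ (2 * (M : ℝ))), ← Real.rpow_mul hapos.le, ← Real.rpow_sub hapos]
      push_cast
      ring_nf
    rw [hL, e1, e2]
    have e3 : ((4 : ℝ) * M) ^ (2 * M) = (((4 : ℝ) * M) ^ M) ^ 2 := by rw [← pow_mul, Nat.mul_comm M 2]
    rw [e3]
    have hq : ((4 : ℝ) * M) ^ M ≠ 0 := by positivity
    have hp : a ^ (2 * (M : ℝ)) ≠ 0 := (Real.rpow_pos_of_pos hapos _).ne'
    field_simp
  have hballae : ∀ n : ℕ, ∀ᵐ x ∂(volume.restrict (ball (0 : EuclideanSpace ℝ (Fin 3)) ((n : ℝ) + 1))), W M x = 0 := by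
    intro n
    have h0 := hball ((n : ℝ) + 1) (by positivity)
    have h1 := (lintegral_eq_zero_iff' (hWmeas.restrict.enorm.pow_const 2)).1 h0
    filter_upwards [h1] with x hx
    simpa using hx
  have h := (ae_restrict_iUnion_iff (μ := (volume : Measure (EuclideanSpace ℝ (Fin 3))))
    (fun n : ℕ => ball (0 : EuclideanSpace ℝ (Fin 3)) ((n : ℝ) + 1)) (fun x => W M x = 0)).2 hballae
  rwa [iUnion_ball_nat_succ, Measure.restrict_univ] at h

/-! ## 5. The member theorem -/
/-- **MEMBERS THAT ARE POLYNOMIAL IN TIME A.E. ON A PAST SLAB ARE TRIVIAL.**  Let `(u, p)` be a suitable weak Euler pair on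
`(−∞,0) × ℝ³` with weak spatial gradient `H` and gauges `a^{2ρ} A(a) + a^{ρ} E(a) + a^{2ρ} D(a) ≤ c` (`ρ > 0`), and suppose
`u(τ, x) = Σ_{k ≤ N} τ^k U_k(x)` for a.e. `(τ, x) ∈ (−∞, T₁) × ℝ³`, some `T₁ ≤ 0`, some `N` and some `U_k : ℝ³ → ℝ³` (no
measurability, regularity or decay assumed).  Then `u = 0` a.e. on the slab (induction on `N`: the top coefficient vanishes by
`top_coeff_ae_eq_zero`, degree `0` is `AePastSteady.ae_eq_zero_of_gauge_of_aePastSteady`). [folklore] -/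
theorem ae_eq_zero_of_gauge_of_aePolynomialPast {ρ : ℝ} (hρ : 0 < ρ)
    {u : ℝ → EuclideanSpace ℝ (Fin 3) → EuclideanSpace ℝ (Fin 3)} {p : ℝ → EuclideanSpace ℝ (Fin 3) → ℝ}
    {H : ℝ → EuclideanSpace ℝ (Fin 3) → EuclideanSpace ℝ (Fin 3) →L[ℝ] EuclideanSpace ℝ (Fin 3)} {c : ℝ≥0}
    (hsw : IsSuitableWeakSolutionOn (slab (EuclideanSpace ℝ (Fin 3)) (Iio 0) isOpen_Iio) 0 0 u p)
    (hH : HasWeakSpatialGradientOn (slab (EuclideanSpace ℝ (Fin 3)) (Iio 0) isOpen_Iio) u H)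
    (hc : ∀ a : ℝ, 0 < a → ENNReal.ofReal (a ^ (2 * ρ)) * cknA a (0 : ℝ × EuclideanSpace ℝ (Fin 3)) u +
        ENNReal.ofReal (a ^ ρ) * cknE a (0 : ℝ × EuclideanSpace ℝ (Fin 3)) H +
        ENNReal.ofReal (a ^ (2 * ρ)) * cknD a (0 : ℝ × EuclideanSpace ℝ (Fin 3)) p ≤ (c : ℝ≥0∞))
    {T₁ : ℝ} (hT₁ : T₁ ≤ 0) (N : ℕ) {U : ℕ → EuclideanSpace ℝ (Fin 3) → EuclideanSpace ℝ (Fin 3)}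
    (hU : ∀ᵐ z ∂(volume.restrict (Iio T₁ ×ˢ (univ : Set (EuclideanSpace ℝ (Fin 3))))),
      u z.1 z.2 = ∑ k ∈ range (N + 1), z.1 ^ k • U k z.2) :
    uncurry u =ᵐ[volume.restrict (Iio (0 : ℝ) ×ˢ (univ : Set (EuclideanSpace ℝ (Fin 3))))] 0 := by
  -- the `A`-gauge on slices, once and for all
  have hA : ∀ a : ℝ, 0 < a → ∀ s ∈ Ioo (-(a ^ 2)) 0,
      ∫⁻ x in ball (0 : EuclideanSpace ℝ (Fin 3)) a, ‖u s x‖ₑ ^ 2 ≤ ENNReal.ofReal ((c : ℝ) * a ^ (1 - 2 * ρ)) :=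
    fun a ha s hs => Backward.lintegral_ball_le_of_gaugeA ha (le_trans (le_add_right (le_add_right le_rfl)) (hc a ha)) hs
  induction N generalizing U with
  | zero =>
    have hU' : ∀ᵐ z ∂(volume.restrict (Iio T₁ ×ˢ (univ : Set (EuclideanSpace ℝ (Fin 3))))), u z.1 z.2 = U 0 z.2 := by
      filter_upwards [hU] with z hz
      simpa using hz
    exact AePastSteady.ae_eq_zero_of_gauge_of_aePastSteady hρ hsw hH hc hT₁ hU'
  | succ N ih =>
    -- good slices
    have hgood : ∀ᵐ τ ∂(volume.restrict (Iio T₁)), LocallyIntegrable (u τ) volume ∧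
        ∀ᵐ x ∂(volume : Measure (EuclideanSpace ℝ (Fin 3))), u τ x = ∑ k ∈ range (N + 1 + 1), τ ^ k • U k x := by
      filter_upwards [FrameSteady.ae_hasWeakFDerivOn_slice_past hH hT₁,
        AffinePast.ae_ae_of_ae_slab (P := fun τ x => u τ x = ∑ k ∈ range (N + 1 + 1), τ ^ k • U k x) hU] with τ hτ hτ'
      exact ⟨locallyIntegrableOn_univ.1 (by simpa only [Opens.coe_top] using hτ.locallyIntegrableOn), hτ'⟩
    -- the top coefficient vanishes a.e.
    have htop : ∀ᵐ x ∂(volume : Measure (EuclideanSpace ℝ (Fin 3))), U (N + 1) x = 0 :=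
      top_coeff_ae_eq_zero (M := N + 1) hρ hT₁ (by omega) hgood hA
    -- descend to degree `N`
    have hU' : ∀ᵐ z ∂(volume.restrict (Iio T₁ ×ˢ (univ : Set (EuclideanSpace ℝ (Fin 3))))),
        u z.1 z.2 = ∑ k ∈ range (N + 1), z.1 ^ k • U k z.2 := by
      filter_upwards [hU, AffinePast.ae_slab_of_ae (T₁ := T₁) htop] with z hz hz0
      rw [hz, Finset.sum_range_succ, hz0, smul_zero, add_zero]
    exact ih hU'

end PolyPast

/-! ## 6. Binder language (`Birth.InClass`) -/
/-- **Binder language: POLYNOMIAL-IN-TIME PAST ⇒ TRIVIAL** — `u(τ, x) = Σ_{k ≤ N} τ^k U_k(x)` for a.e. `(τ, x) ∈ (−∞,T₁) × ℝ³`,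
some `T₁ ≤ 0`, some degree `N`, some `U_k : ℝ³ → ℝ³` (no measurability, regularity or decay; `N = 0` is the a.e.-steady stratum,
`N = 1` the affine one) ⇒ `u = 0` a.e. (`PolyPast.ae_eq_zero_of_gauge_of_aePolynomialPast`).  Equivalently: members with
`∂ₜ^{N+1} u = 0` on a past slab, in the a.e.-polynomial form, are trivial. [folklore] -/
theorem Birth.nonSelfSimilar_of_aePolynomialTimePast :
    ∀ ρ : ℝ, 0 < ρ →
      ∀ (u : ℝ → EuclideanSpace ℝ (Fin 3) → EuclideanSpace ℝ (Fin 3)) (p : ℝ → EuclideanSpace ℝ (Fin 3) → ℝ)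
        (H : ℝ → EuclideanSpace ℝ (Fin 3) → EuclideanSpace ℝ (Fin 3) →L[ℝ] EuclideanSpace ℝ (Fin 3)) (c : ℝ≥0),
        Birth.InClass ρ u p H c →
          (∃ T₁ : ℝ, T₁ ≤ 0 ∧ ∃ N : ℕ, ∃ U : ℕ → EuclideanSpace ℝ (Fin 3) → EuclideanSpace ℝ (Fin 3),
              ∀ᵐ z ∂(volume.restrict (Iio T₁ ×ˢ (univ : Set (EuclideanSpace ℝ (Fin 3))))),
                u z.1 z.2 = ∑ k ∈ range (N + 1), z.1 ^ k • U k z.2) →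
          uncurry u =ᵐ[volume.restrict (Iio (0 : ℝ) ×ˢ (univ : Set (EuclideanSpace ℝ (Fin 3))))] 0 := by
  intro ρ hρ u p H c hcl h
  obtain ⟨T₁, hT₁, N, U, hU⟩ := h
  exact PolyPast.ae_eq_zero_of_gauge_of_aePolynomialPast hρ hcl.1 hcl.2.1 hcl.2.2 hT₁ N hU

end Summit.NavierStokesRegularity.NavierStokesRegularity.Theorems.PowerGaugeEulerLiouville

end
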